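import Summits.QuantumFields.YangMills.Theorems.ParabolicTrajectoryLatticeGapOnTrajectoryStepScalingDefs
import Summits.QuantumFields.YangMills.Theorems.LatticeGapOnTrajectory.Negative.ZeroCoupling
import HarnessLib

/-!
# Crux `LatticeGapOnTrajectory` (stmt-QuantumFields-10523): the format step, slab half
# (stub `stub_formatSlab`, line `step-scaling-contraction`, served slug `StepScalingSketch`)

Helper file (`--supports stmt-QuantumFields-10523`) proving the registered stub `stub_formatSlab` of the
skeleton `Cruxes/LatticeGapOnTrajectory/Lines/step_scaling_contraction.lean` (signature verbatim): a rate
floor `RateFloor r sch (fun k => M ^ n k) κ Δ` (the finite-volume OS gap statement `TorusGapAt` at the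
lattice rate `Δ · a_k` on EVERY symmetric torus `S ≥ M^{n_k}`, eventually in `k`) gives uniform slab
clustering in cluster-expansion format `Transfer.UniformSlabClustering r sch Δ` ON THE SCHEME'S OWN torus,
with constants `p = 0`, `K = 2 + κ`.

The proof is G-blind plumbing. Eventually in `k` the rate floor holds at `k` and `M^{n_k} ≤ L_k`
(`Negative.eventually_sep_le_L`), so the scheme's own torus `S = L_k` (side `sch.side k = 2 L_k + 1`
definitionally) is admissible. For a `[1, w]`-slab observable `X` with sup bound `B` and a separation
`N` with `N + 2w ≤ L_k`: `w < L_k` and `N + 2w ≤ 2 L_k + 1`, so `TorusGapAt` applies and gives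
`‖osCorr τ_N X X‖ ≤ osVar X · e^{−mN} + κ B² e^{−m(2L_k+1−N−2w)}` with `m = Δ a_k ≥ 0`; the variance term
is `osVar X = Re (osCorr id X X) ≤ ‖osCorr id X X‖ ≤ 2B²` (`norm_osCorr_self_le`, total mass one of
Wilson's measure only), and the thermal exponent `2L_k + 1 − N − 2w ≥ N`, whence
`‖osCorr τ_N X X‖ ≤ (2 + κ) B² e^{−Δ a_k N}`. Neither `β_k → ∞` nor `2 ≤ M` is consumed.

References: Glimm–Jaffe, Quantum Physics (1987), §19.7; Osterwalder–Seiler, Ann. Phys. 110 (1978) 440, §2.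
-/

open scoped ComplexConjugate Topology
open Filter MeasureTheory
open Literature.MathematicalPhysics.QuantumLattice Literature.MathematicalPhysics.QuantumFieldTheory
open Summit.QuantumFields.YangMills.Theses.ParabolicTrajectory
open Summit.QuantumFields.YangMills.Cruxes.LatticeGapOnTrajectory.OrbitKantorovichFiniteSize

noncomputable section

namespace Summit.QuantumFields.YangMills.Cruxes.LatticeGapOnTrajectory.StepScaling

/-- **stub_formatSlab** (registered stub of the skeleton `Lines/step_scaling_contraction.lean`, signature
verbatim) — FORMAT, slab half (G-blind plumbing). A rate floor on every torus `S ≥ M^{n_k}` gives uniform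
slab clustering in cluster-expansion format on the scheme's own torus (`S = L_k ≥ M^{n_k}` eventually,
`Negative.eventually_sep_le_L`; `sch.side k = 2 L_k + 1`): for `N + 2w ≤ L_k` the thermal exponent
`2L_k + 1 − N − 2w ≥ N`, and `osVar X ≤ ‖osCorr id X X‖ ≤ 2B²`, so `‖osCorr τ_N X X‖ ≤ (2 + κ) B² e^{−Δ a_k N}`:
constants `p = 0`, `K = 2 + κ`. The hypotheses `2 ≤ M` and `β_k → ∞` are not used (the slab half needs no
positivity). (Glimm–Jaffe 1987 §19.7; Osterwalder–Seiler 1978 §2.) -/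
theorem stub_formatSlab :
    ∀ (G : Type) [Group G] [TopologicalSpace G] [IsTopologicalGroup G] [CompactSpace G]
      [MeasurableSpace G] [BorelSpace G] (r : LatticeRep G) (M : ℕ) (sch : SpeciesScheme (YMSpecies G))
      (n : ℕ → ℕ) (κ Δ : ℝ),
        2 ≤ M → (∀ k, sch.a k = ((M : ℝ) ^ n k)⁻¹) → Tendsto sch.β atTop atTop → 0 ≤ κ → 0 < Δ →
        RateFloor r sch (fun k => M ^ n k) κ Δ → Transfer.UniformSlabClustering r sch Δ := by
  intro G _ _ _ _ _ _ r M sch n κ Δ hM ha _ hκ hΔ hfloor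
  refine ⟨0, 2 + κ, by linarith, ?_⟩
  have hfloor' : ∀ᶠ k in atTop, ∀ S : ℕ, M ^ n k ≤ S → TorusGapAt r.ρ (sch.β k) S (Δ * sch.a k) κ :=
    hfloor
  have hsep : ∀ᶠ k in atTop, M ^ n k ≤ sch.L k :=
    Summit.QuantumFields.YangMills.Theorems.LatticeGapOnTrajectory.Negative.eventually_sep_le_L sch ha
  filter_upwards [hfloor', hsep] with k hk hLk
  intro w N X B hX hB hdep hN
  have hD : 1 ≤ M ^ n k := Nat.one_le_pow _ _ (by omega)
  have hL1 : 1 ≤ sch.L k := hD.trans hLk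
  have hw : w < sch.L k := by omega
  have hn : N + 2 * w ≤ 2 * sch.L k + 1 := by omega
  have hm0 : 0 ≤ Δ * sch.a k := (mul_pos hΔ (sch.a_pos k)).le
  -- the finite-volume OS gap statement on the scheme's own torus `S = L_k` (`sch.side k = 2 L_k + 1`)
  have h : ‖osCorr (wilsonMeasure r.ρ (sch.β k)) GaugeConfig.negReflect (torusTimeShift (sch.side k) N)
        X X‖ ≤
      osVar (wilsonMeasure r.ρ (sch.β k)) GaugeConfig.negReflect X * Real.exp (-(Δ * sch.a k * N)) +
        κ * B ^ 2 * Real.exp (-(Δ * sch.a k * ((2 * sch.L k + 1 : ℝ) - N - 2 * w))) :=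
    hk (sch.L k) hLk w N X B hX hB hdep hw hn
  -- the variance term: `osVar X ≤ ‖osCorr id X X‖ ≤ 2 B²`
  haveI := isProbabilityMeasure_wilsonMeasure (d := 4) (L := sch.side k) (G := G) r.ρ r.continuous (sch.β k)
  have hVle : osVar (wilsonMeasure r.ρ (sch.β k)) GaugeConfig.negReflect X ≤ 2 * B ^ 2 :=
    (Complex.re_le_norm _).trans (norm_osCorr_self_le _ _ _ hB)
  have hV : osVar (wilsonMeasure r.ρ (sch.β k)) GaugeConfig.negReflect X * Real.exp (-(Δ * sch.a k * N)) ≤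
      2 * B ^ 2 * Real.exp (-(Δ * sch.a k * N)) :=
    mul_le_mul_of_nonneg_right hVle (Real.exp_pos _).le
  -- the thermal term: `2 L_k + 1 - N - 2 w ≥ N`
  have hexp : Real.exp (-(Δ * sch.a k * ((2 * sch.L k + 1 : ℝ) - N - 2 * w))) ≤
      Real.exp (-(Δ * sch.a k * N)) := by
    rw [Real.exp_le_exp]
    have hN' : (N : ℝ) + 2 * w ≤ sch.L k := by exact_mod_cast hN
    have hw0 : (0 : ℝ) ≤ w := Nat.cast_nonneg w
    have hle : (N : ℝ) ≤ (2 * sch.L k + 1 : ℝ) - N - 2 * w := by linarith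
    have := mul_le_mul_of_nonneg_left hle hm0
    linarith
  have hth : κ * B ^ 2 * Real.exp (-(Δ * sch.a k * ((2 * sch.L k + 1 : ℝ) - N - 2 * w))) ≤
      κ * B ^ 2 * Real.exp (-(Δ * sch.a k * N)) :=
    mul_le_mul_of_nonneg_left hexp (mul_nonneg hκ (sq_nonneg B))
  have hE : -Δ * sch.a k * N = -(Δ * sch.a k * N) := by ring
  rw [pow_zero, mul_one, hE]
  linarith

end Summit.QuantumFields.YangMills.Cruxes.LatticeGapOnTrajectory.StepScaling

end
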